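/-
Width seat `ym-line-cbag-p1-w2` (prover-ym-line-cbag-p1-w2-g2-0; own items 22254/22893 closed), route `ColdBoxAllGroups`, helping crux
`BulkAllGroups` (stmt-QuantumFields-22255), line `dlr-chessboard-G` (lead `ym-line-cbag-p2`): the goodTDE SANDWICH — the Gaussian small-field
region lies in the good event with datum, and its complement has exponentially small Gaussian mass — G-port of
`…BulkDominatesColdBoxWChartCoordsShiftBound` + `…BulkDominatesColdBoxWSmallFieldGoodTD` in the lead's datum vocabulary.
-/
import Summits.QuantumFields.YangMills.Theorems.ColdBoxAllGroupsBulkAllGroupsTiltBoundDatumG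
import Summits.QuantumFields.YangMills.Theorems.ColdBoxAllGroupsBulkAllGroupsGlueShiftBoundsG
import Summits.QuantumFields.YangMills.Theorems.ColdBoxAllGroupsBoxFloorAllGroupsGaussTailD

/-!
# Crux `BulkAllGroups` (stmt-QuantumFields-22255), stubs N2-cov-G / N2-mean-G: the goodTDE sandwich (ϑ-twin of the BOX line's
# `smallField_subset_goodTE_inter_ball` / `gaussD_real_compl_goodTE_inter_ball_le`), every compact group presented in `U(N)`

With an exterior datum `ϑ` (colour-major, `Σ_c ϑ_{c,e}² ≤ r²` off the cold box `Λ`, `ϑ = 0` on the temporal forest; scaled datum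
`ϑ'_c = sdatE β ϑ c = √β•ϑ_c`, backgrounds `F_c(p) = sCirc (glue ϑ'_c (mean ϑ'_c)) p` bounded by `R'`) the chart coordinates of the datum
configuration `cfgTDE ρ H β ϑ t` are `v_e = extDatum (datVec ϑ) (unscaleTE H D β (t + μ')) e`; on the enlarged box `√β·v_{e,c} = A_c(e)`,
`A_c = glue ϑ'_c (mean ϑ'_c + t_c)` (the lead's `sqrt_mul_extDatum_unscaleTE_eq`), off the cold box `v_e = ϑ(e)`.

* step 2 `abs_sqrt_mul_extDatum_le_of_smallField` / `sum_sq_extDatum_shift_leE` / **`norm_extDatum_shift_le_of_smallField`** — if every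
  Dirichlet circulation of every colour of `t` is `≤ R`, then on the cold box `Σ_c v_{e,c}² ≤ D·ρ²/β`, `ρ = (12H²+2H+1)((R+R') + 4√β·r)` (per
  colour `|A_c(e)| ≤ ρ`: `abs_glue_smul_shift_le`), off it `‖v_e‖ ≤ r`; hence `‖v_e‖ ≤ m` whenever `m_E := √D·ρ/√β ≤ m` and `r ≤ m`;
* step 3 `plaqCostAt_cfgTDE_le_of_smallField` — if moreover `m ≤ 1/4`, every plaquette touching `Λ` costs `≤ (D/2)(R+R')²/β + 190·m³`
  (`qObsDE p t = ½Σ_c (F_c(p) + dirCirc_p t_c)² ≤ (D/2)(R+R')²`, R3 with datum `abs_beta_mul_plaqCostAt_sub_qObsDE_le`);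
* **`smallField_subset_goodTDE_inter_ball`** — under the window `(D/2)(R+R')²/β + 190·m³ < β^{2ε−1}` (`m_E ≤ m`, `r ≤ m ≤ 1/4`; the cubic term
  carries `m = max(m_E, r)` because a touching plaquette may have collar edges) the Gaussian small-field region
  `{t | ∀ c p, |dirCirc_p (t c)| ≤ R}` lies in `goodTDE ρ H β ε ϑ ∩ {t | ∀ e, ‖unscaleTE (t + μ') e‖ ≤ m}`;
* **`gaussD_real_compl_goodTDE_inter_ball_le`** — hence `gaussD((goodTDE ∩ ball)ᶜ) ≤ 240·D·(2H+1)⁴·e^{−R²/2}` (`measureReal_gaussD_not_smallField_le`).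
* (W1)/(W2) in the lead's hypothesis shape (PLAN v6): `abs_qObsDE_sub_beta_mul_plaqCostAt_le`, `abs_tiltWDE_le_of_window`, and the good-event
  form `abs_indicator_tiltWDE_le` (hypothesis `(hWb)` of the cores), from the sibling file `…BulkAllGroupsTiltBoundDatumG`.
At `ϑ = 0` (`r = R' = 0`) these are the BOX line's statements (module `…BoxFloorAllGroupsGaussTailD`).  No sorry; no definition; standard axioms.
NOT a claim about the mass gap: rung-level support (R2xi-G `XiPow`, RECORD label); the Yang–Mills mass gap is NOT proved by any of this.
-/

set_option autoImplicit false

noncomputable section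

open MeasureTheory Finset Real
open Literature.Probability.LatticeModels (Site)
open Literature.MathematicalPhysics.QuantumLattice
open Literature.MathematicalPhysics.QuantumFieldTheory
open Literature.MathematicalPhysics.QuantumFieldTheory.LatticeMaxwell
open Literature.MathematicalPhysics.QuantumFieldTheory.AxialGauge
open Summit.QuantumFields.YangMills.Theorems.WeakCouplingRates
open Summit.QuantumFields.YangMills.Theorems.FreeEnergyLogCoefficient

namespace Summit.QuantumFields.YangMills.Theorems.ColdBoxAllGroups

variable {N : ℕ} {G : Type} [Group G] (ρ : G →* Matrix (Fin N) (Fin N) ℂ) {H : ℕ}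

/-! ## Step 2 — the chart coordinates of the datum configuration are small on the Gaussian small-field region -/

/-- Per colour, on the enlarged box: the scaled chart coordinate IS the shifted glued field, hence small —
`|√β · v_{e,c}| ≤ (12H²+2H+1)((R+R') + 4(√β·r))`. -/
theorem abs_sqrt_mul_extDatum_le_of_smallField {D : ℕ} {β : ℝ} (hβ : 0 < β) (hH : 1 ≤ H)
    {ϑ : Fin D → Literature.MathematicalPhysics.QuantumLattice.ZdEdge 4 → ℝ} {r R R' : ℝ} (hr : 0 ≤ r) (hR : 0 ≤ R) (hR' : 0 ≤ R')
    (hϑ : ∀ e, e ∉ boxEdges 4 (2 * H + 1) → ‖datVec ϑ e‖ ≤ r)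
    (hforest : ∀ x : Site 4, (∀ k : Fin 4, 1 ≤ x k ∧ x k + 1 ≤ 2 * (H : ℤ)) → ∀ c, ϑ c (x, 0) = 0)
    {t : TSpaceD H D}
    (ht : ∀ (c : Fin D) (p : ZdPlaquette 4), |dirCirc H (p.1, p.2.1.1, p.2.1.2) (t c)| ≤ R)
    (hF : ∀ (c : Fin D) (p : ZdPlaquette 4), |sCirc (glue (pin := fun e => e ∉ dirFreeEdges H) dirCorner (2 * H + 3) (sdatE β ϑ c)
        (mean (fun e => e ∉ dirFreeEdges H) dirCorner (2 * H + 3) (sdatE β ϑ c))) (p.1, p.2.1.1, p.2.1.2)| ≤ R')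
    (c : Fin D) {e : Literature.MathematicalPhysics.QuantumLattice.ZdEdge 4} (he : e ∈ boxEdgesAt dirCorner (2 * H + 3)) :
    |Real.sqrt β * extDatum (datVec ϑ) (unscaleTE H D β (t + meanTE H D β ϑ)) e c| ≤
      (12 * (H : ℝ) ^ 2 + 2 * H + 1) * ((R + R') + 4 * (Real.sqrt β * r)) := by
  have hc : 0 < Real.sqrt β := Real.sqrt_pos.2 hβ
  have hθ : ∀ e', e' ∉ boxEdges 4 (2 * H + 1) → |ϑ c e'| ≤ r := fun e' he' =>
    abs_apply_le_of_sum_sq_le' hr (by rw [← norm_datVec_sq]; exact pow_le_pow_left₀ (norm_nonneg _) (hϑ e' he') 2) c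
  have hF' : ∀ p : ZdPlaquette 4, |sCirc (glue (pin := fun e => e ∉ dirFreeEdges H) dirCorner (2 * H + 3) (Real.sqrt β • ϑ c)
      (mean (fun e => e ∉ dirFreeEdges H) dirCorner (2 * H + 3) (Real.sqrt β • ϑ c))) (p.1, p.2.1.1, p.2.1.2)| ≤ R' :=
    fun p => hF c p
  have hA := abs_glue_smul_shift_le (H := H) hH (Real.sqrt β) hr hR hR' hθ (fun x hx => hforest x hx c) (t := t c) (ht c) hF' e
  rw [abs_of_pos hc] at hA
  have hid := sqrt_mul_extDatum_unscaleTE_eq (H := H) hβ ϑ hforest (t + meanTE H D β ϑ) c he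
  have hs : WithLp.ofLp ((t + meanTE H D β ϑ) c) =
      mean (fun e => e ∉ dirFreeEdges H) dirCorner (2 * H + 3) (sdatE β ϑ c) + WithLp.ofLp (t c) := by
    rw [Pi.add_apply, WithLp.ofLp_add, meanTE_apply, add_comm]
  rw [hid, hs]
  exact hA

/-- **goodTDE sandwich, step 2 (sum of squares)**: with `ρ = (12H²+2H+1)((R+R') + 4(√β·r))`, for every edge ON the cold box
`Σ_c v_{e,c}² ≤ D·ρ²/β`, and off the cold box `Σ_c v_{e,c}² ≤ r²` (`v = extDatum (datVec ϑ) (unscaleTE H D β (t + μ'))`). -/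
theorem sum_sq_extDatum_shift_leE {D : ℕ} {β : ℝ} (hβ : 0 < β) (hH : 1 ≤ H)
    {ϑ : Fin D → Literature.MathematicalPhysics.QuantumLattice.ZdEdge 4 → ℝ} {r R R' : ℝ} (hr : 0 ≤ r) (hR : 0 ≤ R) (hR' : 0 ≤ R')
    (hϑ : ∀ e, e ∉ boxEdges 4 (2 * H + 1) → ‖datVec ϑ e‖ ≤ r)
    (hforest : ∀ x : Site 4, (∀ k : Fin 4, 1 ≤ x k ∧ x k + 1 ≤ 2 * (H : ℤ)) → ∀ c, ϑ c (x, 0) = 0)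
    {t : TSpaceD H D}
    (ht : ∀ (c : Fin D) (p : ZdPlaquette 4), |dirCirc H (p.1, p.2.1.1, p.2.1.2) (t c)| ≤ R)
    (hF : ∀ (c : Fin D) (p : ZdPlaquette 4), |sCirc (glue (pin := fun e => e ∉ dirFreeEdges H) dirCorner (2 * H + 3) (sdatE β ϑ c)
        (mean (fun e => e ∉ dirFreeEdges H) dirCorner (2 * H + 3) (sdatE β ϑ c))) (p.1, p.2.1.1, p.2.1.2)| ≤ R')
    {e : Literature.MathematicalPhysics.QuantumLattice.ZdEdge 4} (heΛ : e ∈ boxEdges 4 (2 * H + 1)) :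
    ∑ c, extDatum (datVec ϑ) (unscaleTE H D β (t + meanTE H D β ϑ)) e c ^ 2 ≤
      (D : ℝ) * ((12 * (H : ℝ) ^ 2 + 2 * H + 1) * ((R + R') + 4 * (Real.sqrt β * r))) ^ 2 / β := by
  have hE : e ∈ boxEdgesAt dirCorner (2 * H + 3) := boxEdges_subset_boxEdgesAt_dirCorner H heΛ
  have hc : 0 < Real.sqrt β := Real.sqrt_pos.2 hβ
  have hβ2 : Real.sqrt β ^ 2 = β := Real.sq_sqrt hβ.le
  have hcomp : ∀ c, |extDatum (datVec ϑ) (unscaleTE H D β (t + meanTE H D β ϑ)) e c| ≤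
      (12 * (H : ℝ) ^ 2 + 2 * H + 1) * ((R + R') + 4 * (Real.sqrt β * r)) / Real.sqrt β := by
    intro c
    have h := abs_sqrt_mul_extDatum_le_of_smallField hβ hH hr hR hR' hϑ hforest ht hF c hE
    rw [abs_mul, abs_of_pos hc, mul_comm] at h
    rwa [le_div_iff₀ hc]
  have h := sum_sq_le_card_mul_sq _ hcomp
  refine h.trans (le_of_eq ?_)
  rw [div_pow, hβ2]; ring

/-- **goodTDE sandwich, step 2 (norm form)**: if `√D·ρ/√β ≤ m` and `r ≤ m`, every chart coordinate of the datum configuration has `‖v_e‖ ≤ m`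
(on the box by the previous lemma, off the box because `v_e = ϑ(e)`). -/
theorem norm_extDatum_shift_le_of_smallField {D : ℕ} {β m : ℝ} (hβ : 0 < β) (hH : 1 ≤ H)
    {ϑ : Fin D → Literature.MathematicalPhysics.QuantumLattice.ZdEdge 4 → ℝ} {r R R' : ℝ} (hr : 0 ≤ r) (hR : 0 ≤ R) (hR' : 0 ≤ R')
    (hϑ : ∀ e, e ∉ boxEdges 4 (2 * H + 1) → ‖datVec ϑ e‖ ≤ r)
    (hforest : ∀ x : Site 4, (∀ k : Fin 4, 1 ≤ x k ∧ x k + 1 ≤ 2 * (H : ℤ)) → ∀ c, ϑ c (x, 0) = 0)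
    {t : TSpaceD H D}
    (ht : ∀ (c : Fin D) (p : ZdPlaquette 4), |dirCirc H (p.1, p.2.1.1, p.2.1.2) (t c)| ≤ R)
    (hF : ∀ (c : Fin D) (p : ZdPlaquette 4), |sCirc (glue (pin := fun e => e ∉ dirFreeEdges H) dirCorner (2 * H + 3) (sdatE β ϑ c)
        (mean (fun e => e ∉ dirFreeEdges H) dirCorner (2 * H + 3) (sdatE β ϑ c))) (p.1, p.2.1.1, p.2.1.2)| ≤ R')
    (hmEm : Real.sqrt D * ((12 * (H : ℝ) ^ 2 + 2 * H + 1) * ((R + R') + 4 * (Real.sqrt β * r))) / Real.sqrt β ≤ m) (hrm : r ≤ m)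
    (e : Literature.MathematicalPhysics.QuantumLattice.ZdEdge 4) :
    ‖extDatum (datVec ϑ) (unscaleTE H D β (t + meanTE H D β ϑ)) e‖ ≤ m := by
  by_cases hΛ : e ∈ boxEdges 4 (2 * H + 1)
  · have hmE0 : 0 ≤ Real.sqrt D * ((12 * (H : ℝ) ^ 2 + 2 * H + 1) * ((R + R') + 4 * (Real.sqrt β * r))) / Real.sqrt β := by
      positivity
    have hsq : ‖extDatum (datVec ϑ) (unscaleTE H D β (t + meanTE H D β ϑ)) e‖ ^ 2 ≤
        (Real.sqrt D * ((12 * (H : ℝ) ^ 2 + 2 * H + 1) * ((R + R') + 4 * (Real.sqrt β * r))) / Real.sqrt β) ^ 2 := by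
      rw [EuclideanSpace.real_norm_sq_eq]
      refine (sum_sq_extDatum_shift_leE hβ hH hr hR hR' hϑ hforest ht hF hΛ).trans (le_of_eq ?_)
      have hD : Real.sqrt (D : ℝ) ^ 2 = D := Real.sq_sqrt (Nat.cast_nonneg _)
      have hβ2 : Real.sqrt β ^ 2 = β := Real.sq_sqrt hβ.le
      rw [div_pow, mul_pow, mul_pow, hD, hβ2]; ring
    exact ((pow_le_pow_iff_left₀ (norm_nonneg _) hmE0 two_ne_zero).1 hsq).trans hmEm
  · rw [extDatum_of_not_mem _ _ hΛ]
    exact (hϑ e hΛ).trans hrm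

/-- The surrogate with datum on the small-field region: `qObsDE p t ≤ (D/2)·(R + R')²` when the backgrounds are `≤ R'` and the circulations `≤ R`. -/
theorem qObsDE_le_of_smallField {D : ℕ} {β R R' : ℝ}
    (ϑ : Fin D → Literature.MathematicalPhysics.QuantumLattice.ZdEdge 4 → ℝ) (p : Plaq 4) (t : TSpaceD H D)
    (ht : ∀ c : Fin D, |dirCirc H p (t c)| ≤ R)
    (hF : ∀ c : Fin D, |sCirc (glue (pin := fun e => e ∉ dirFreeEdges H) dirCorner (2 * H + 3) (sdatE β ϑ c)
        (mean (fun e => e ∉ dirFreeEdges H) dirCorner (2 * H + 3) (sdatE β ϑ c))) p| ≤ R') :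
    qObsDE H D β ϑ p t ≤ (D : ℝ) / 2 * (R + R') ^ 2 := by
  rw [qObsDE_eq_half_sum_sq]
  have hk : ∀ c : Fin D, |sCirc (glue (pin := fun e => e ∉ dirFreeEdges H) dirCorner (2 * H + 3) (sdatE β ϑ c)
      (mean (fun e => e ∉ dirFreeEdges H) dirCorner (2 * H + 3) (sdatE β ϑ c))) p + dirCirc H p (t c)| ≤ R + R' := fun c =>
    (abs_add_le _ _).trans (by linarith [hF c, ht c])
  have h := sum_sq_le_card_mul_sq _ hk
  have : (1 / 2 : ℝ) * ((D : ℝ) * (R + R') ^ 2) = (D : ℝ) / 2 * (R + R') ^ 2 := by ring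
  rw [← this]
  exact mul_le_mul_of_nonneg_left h (by norm_num)

/-! ## Step 3 — plaquette costs on the small-field region, and the sandwich -/

section Chart

variable [TopologicalSpace G] [CompactSpace G]

/-- **Plaquette costs of the datum configuration on the Gaussian small-field region.**  For continuous unitary-valued `ρ`, `β > 0`, `H ≥ 1`,
an exterior datum as above and `t` with all Dirichlet circulations `≤ R`: if `r² + D·ρ²/β ≤ m²` with `0 ≤ m ≤ 1/4`, then every plaquette
touching the cold box costs `≤ (D/2)(R+R')²/β + 190·m³` in `cfgTDE ρ H β ϑ t` (`D = dimE ρ`). -/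
theorem plaqCostAt_cfgTDE_le_of_smallField (hρ : Continuous ρ) {β m r R R' : ℝ} (hβ : 0 < β) (hH : 1 ≤ H)
    (hr : 0 ≤ r) (hR : 0 ≤ R) (hR' : 0 ≤ R')
    {ϑ : Fin (dimE ρ) → Literature.MathematicalPhysics.QuantumLattice.ZdEdge 4 → ℝ}
    (hϑ : ∀ e, e ∉ boxEdges 4 (2 * H + 1) → ‖datVec ϑ e‖ ≤ r)
    (hforest : ∀ x : Site 4, (∀ k : Fin 4, 1 ≤ x k ∧ x k + 1 ≤ 2 * (H : ℤ)) → ∀ c, ϑ c (x, 0) = 0)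
    (hF : ∀ (c : Fin (dimE ρ)) (p : ZdPlaquette 4), |sCirc (glue (pin := fun e => e ∉ dirFreeEdges H) dirCorner (2 * H + 3) (sdatE β ϑ c)
        (mean (fun e => e ∉ dirFreeEdges H) dirCorner (2 * H + 3) (sdatE β ϑ c))) (p.1, p.2.1.1, p.2.1.2)| ≤ R')
    (hmEm : Real.sqrt (dimE ρ) * ((12 * (H : ℝ) ^ 2 + 2 * H + 1) * ((R + R') + 4 * (Real.sqrt β * r))) / Real.sqrt β ≤ m)
    (hrm : r ≤ m) (hm4 : m ≤ 1 / 4) (t : TSpaceD H (dimE ρ))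
    (ht : ∀ (c : Fin (dimE ρ)) (p : ZdPlaquette 4), |dirCirc H (p.1, p.2.1.1, p.2.1.2) (t c)| ≤ R)
    {p : ZdPlaquette 4} (hp : p ∈ plaquettesTouching (boxEdges 4 (2 * H + 1))) :
    plaqCostAt ρ p.1 p.2.1.1 p.2.1.2 (cfgTDE ρ H β ϑ t) ≤ (dimE ρ : ℝ) / 2 * (R + R') ^ 2 / β + 190 * m ^ 3 := by
  have hlink : ∀ e, ‖extDatum (datVec ϑ) (unscaleTE H (dimE ρ) β (t + meanTE H (dimE ρ) β ϑ)) e‖ ≤ m :=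
    norm_extDatum_shift_le_of_smallField hβ hH hr hR hR' hϑ hforest ht hF hmEm hrm
  have hcub := abs_beta_mul_plaqCostAt_sub_qObsDE_le ρ hρ hβ hm4 hforest t hlink hp
  have hq : qObsDE H (dimE ρ) β ϑ (p.1, p.2.1.1, p.2.1.2) t ≤ (dimE ρ : ℝ) / 2 * (R + R') ^ 2 :=
    qObsDE_le_of_smallField ϑ _ t (fun c => ht c p) (fun c => hF c p)
  have h2 := (abs_le.1 hcub).2
  have hβcost : β * plaqCostAt ρ p.1 p.2.1.1 p.2.1.2 (cfgTDE ρ H β ϑ t) ≤ (dimE ρ : ℝ) / 2 * (R + R') ^ 2 + β * (190 * m ^ 3) := by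
    linarith
  have : plaqCostAt ρ p.1 p.2.1.1 p.2.1.2 (cfgTDE ρ H β ϑ t) ≤ ((dimE ρ : ℝ) / 2 * (R + R') ^ 2 + β * (190 * m ^ 3)) / β := by
    rw [le_div_iff₀ hβ]; linarith
  refine this.trans (le_of_eq ?_)
  field_simp

/-- **The goodTDE sandwich**: under the windows `r² + D·ρ²/β ≤ m²`, `0 ≤ m ≤ 1/4` and `(D/2)(R+R')²/β + 190·m³ < β^{2ε−1}`, the Gaussian
small-field region lies inside the good event with datum intersected with the chart window of the SHIFTED free-link data:
`{t | ∀ c p, |dirCirc_p (t c)| ≤ R} ⊆ goodTDE ρ H β ε ϑ ∩ {t | ∀ e, ‖unscaleTE H D β (t + μ') e‖ ≤ m}`. -/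
theorem smallField_subset_goodTDE_inter_ball (hρ : Continuous ρ) {β ε m r R R' : ℝ} (hβ : 0 < β) (hH : 1 ≤ H)
    (hr : 0 ≤ r) (hR : 0 ≤ R) (hR' : 0 ≤ R')
    {ϑ : Fin (dimE ρ) → Literature.MathematicalPhysics.QuantumLattice.ZdEdge 4 → ℝ}
    (hϑ : ∀ e, e ∉ boxEdges 4 (2 * H + 1) → ‖datVec ϑ e‖ ≤ r)
    (hforest : ∀ x : Site 4, (∀ k : Fin 4, 1 ≤ x k ∧ x k + 1 ≤ 2 * (H : ℤ)) → ∀ c, ϑ c (x, 0) = 0)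
    (hF : ∀ (c : Fin (dimE ρ)) (p : ZdPlaquette 4), |sCirc (glue (pin := fun e => e ∉ dirFreeEdges H) dirCorner (2 * H + 3) (sdatE β ϑ c)
        (mean (fun e => e ∉ dirFreeEdges H) dirCorner (2 * H + 3) (sdatE β ϑ c))) (p.1, p.2.1.1, p.2.1.2)| ≤ R')
    (hmEm : Real.sqrt (dimE ρ) * ((12 * (H : ℝ) ^ 2 + 2 * H + 1) * ((R + R') + 4 * (Real.sqrt β * r))) / Real.sqrt β ≤ m)
    (hrm : r ≤ m) (hm4 : m ≤ 1 / 4) (hwin : (dimE ρ : ℝ) / 2 * (R + R') ^ 2 / β + 190 * m ^ 3 < β ^ (2 * ε - 1)) :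
    {t : TSpaceD H (dimE ρ) | ∀ (c : Fin (dimE ρ)) (p : ZdPlaquette 4), |dirCirc H (p.1, p.2.1.1, p.2.1.2) (t c)| ≤ R} ⊆
      goodTDE ρ H β ε ϑ ∩ {t | ∀ e : ColdFreeIdx H, ‖unscaleTE H (dimE ρ) β (t + meanTE H (dimE ρ) β ϑ) e‖ ≤ m} := by
  intro t ht
  simp only [Set.mem_setOf_eq] at ht
  refine ⟨?_, fun e => ?_⟩
  · rw [mem_goodTDE_iff, mem_coldGoodSetG_iff]
    intro p hp
    exact (plaqCostAt_cfgTDE_le_of_smallField ρ hρ hβ hH hr hR hR' hϑ hforest hF hmEm hrm hm4 t ht hp).trans_lt hwin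
  · have h := norm_extDatum_shift_le_of_smallField hβ hH hr hR hR' hϑ hforest ht hF hmEm hrm e.1.1
    rwa [extDatum_apply_free] at h

/-- **The Gaussian mass of the bad event with datum is exponentially small**: under the windows of `smallField_subset_goodTDE_inter_ball`,
`gaussD((goodTDE ∩ ball)ᶜ) ≤ 240·D·(2H+1)⁴·e^{−R²/2}`. -/
theorem gaussD_real_compl_goodTDE_inter_ball_le (hρ : Continuous ρ) {β ε m r R R' : ℝ} (hβ : 0 < β) (hH : 1 ≤ H)
    (hr : 0 ≤ r) (hR : 0 ≤ R) (hR' : 0 ≤ R')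
    {ϑ : Fin (dimE ρ) → Literature.MathematicalPhysics.QuantumLattice.ZdEdge 4 → ℝ}
    (hϑ : ∀ e, e ∉ boxEdges 4 (2 * H + 1) → ‖datVec ϑ e‖ ≤ r)
    (hforest : ∀ x : Site 4, (∀ k : Fin 4, 1 ≤ x k ∧ x k + 1 ≤ 2 * (H : ℤ)) → ∀ c, ϑ c (x, 0) = 0)
    (hF : ∀ (c : Fin (dimE ρ)) (p : ZdPlaquette 4), |sCirc (glue (pin := fun e => e ∉ dirFreeEdges H) dirCorner (2 * H + 3) (sdatE β ϑ c)
        (mean (fun e => e ∉ dirFreeEdges H) dirCorner (2 * H + 3) (sdatE β ϑ c))) (p.1, p.2.1.1, p.2.1.2)| ≤ R')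
    (hmEm : Real.sqrt (dimE ρ) * ((12 * (H : ℝ) ^ 2 + 2 * H + 1) * ((R + R') + 4 * (Real.sqrt β * r))) / Real.sqrt β ≤ m)
    (hrm : r ≤ m) (hm4 : m ≤ 1 / 4) (hwin : (dimE ρ : ℝ) / 2 * (R + R') ^ 2 / β + 190 * m ^ 3 < β ^ (2 * ε - 1)) :
    (gaussD H (dimE ρ)).real
        (goodTDE ρ H β ε ϑ ∩ {t | ∀ e : ColdFreeIdx H, ‖unscaleTE H (dimE ρ) β (t + meanTE H (dimE ρ) β ϑ) e‖ ≤ m})ᶜ ≤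
      240 * (dimE ρ) * (2 * (H : ℝ) + 1) ^ 4 * Real.exp (-R ^ 2 / 2) :=
  (measureReal_mono (Set.compl_subset_compl.2
    (smallField_subset_goodTDE_inter_ball ρ hρ hβ hH hr hR hR' hϑ hforest hF hmEm hrm hm4 hwin))).trans
    (measureReal_gaussD_not_smallField_le H (dimE ρ) hR)

/-! ## W1/W2 in the lead's hypothesis shape (exterior datum and free-link window both `≤ m`) -/

omit [TopologicalSpace G] [CompactSpace G] in
/-- Every chart coordinate `extDatum (datVec ϑ) w e` is `≤ m` when the exterior datum and the free-link data are (`m ≥ 0`; forest coordinates vanish). -/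
theorem norm_extDatum_le_of_datVec_window (ϑ : Fin (dimE ρ) → Literature.MathematicalPhysics.QuantumLattice.ZdEdge 4 → ℝ)
    (w : ColdFreeIdx H → EuclideanSpace ℝ (Fin (dimE ρ))) {m : ℝ} (hm0 : 0 ≤ m)
    (hϑ : ∀ e, e ∉ boxEdges 4 (2 * H + 1) → ‖datVec ϑ e‖ ≤ m) (hw : ∀ e, ‖w e‖ ≤ m)
    (e : Literature.MathematicalPhysics.QuantumLattice.ZdEdge 4) : ‖extDatum (datVec ϑ) w e‖ ≤ m := by
  by_cases hΛ : e ∈ boxEdges 4 (2 * H + 1)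
  · by_cases hf : (e.2 = 0 ∧ ∀ k : Fin 4, 1 ≤ e.1 k ∧ e.1 k + 1 ≤ 2 * (H : ℤ))
    · obtain ⟨x, j⟩ := e
      obtain ⟨hj, hx⟩ := hf
      simp only at hj hx
      subst hj
      rw [extDatum_of_forest _ _ hx, norm_zero]; exact hm0
    · have := extDatum_apply_free (datVec ϑ) w ⟨⟨e, hΛ⟩, hf⟩
      rw [this]; exact hw _
  · rw [extDatum_of_not_mem _ _ hΛ]; exact hϑ e hΛ

/-- **(W1) R3 with datum in the lead's hypothesis shape**: exterior datum `‖datVec ϑ e‖ ≤ m` off the box, free-link window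
`‖unscaleTE (t + μ') e‖ ≤ m`, `0 ≤ m ≤ 1/4`, `ϑ = 0` on the forest ⇒ for every plaquette `p` touching the cold box
`|qObsDE p t − β·cost_p(cfgTDE t)| ≤ 190·β·m³`. -/
theorem abs_qObsDE_sub_beta_mul_plaqCostAt_le (hρ : Continuous ρ) {β m : ℝ} (hβ : 0 < β) (hm0 : 0 ≤ m) (hm : m ≤ 1 / 4)
    {ϑ : Fin (dimE ρ) → Literature.MathematicalPhysics.QuantumLattice.ZdEdge 4 → ℝ}
    (hforest : ∀ x : Site 4, (∀ k : Fin 4, 1 ≤ x k ∧ x k + 1 ≤ 2 * (H : ℤ)) → ∀ c, ϑ c (x, 0) = 0)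
    (hϑ : ∀ e, e ∉ boxEdges 4 (2 * H + 1) → ‖datVec ϑ e‖ ≤ m) (t : TSpaceD H (dimE ρ))
    (ht : ∀ e : ColdFreeIdx H, ‖unscaleTE H (dimE ρ) β (t + meanTE H (dimE ρ) β ϑ) e‖ ≤ m)
    {p : ZdPlaquette 4} (hp : p ∈ plaquettesTouching (boxEdges 4 (2 * H + 1))) :
    |qObsDE H (dimE ρ) β ϑ (p.1, p.2.1.1, p.2.1.2) t - β * plaqCostAt ρ p.1 p.2.1.1 p.2.1.2 (cfgTDE ρ H β ϑ t)| ≤ 190 * β * m ^ 3 := by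
  rw [abs_sub_comm]
  exact abs_beta_mul_plaqCostAt_sub_qObsDE_le ρ hρ hβ hm hforest t (norm_extDatum_le_of_datVec_window ρ ϑ _ hm0 hϑ ht) hp

/-- **(W2) T4 in the lead's hypothesis shape**: under the hypotheses of (W1) and `|log g(a)| ≤ ℓ` for `‖a‖ ≤ m`,
`|tiltWDE ρ H g β ϑ t| ≤ #(plaquettesTouching Λ)·190·β·m³ + #(ColdFreeIdx H)·ℓ`. -/
theorem abs_tiltWDE_le_of_window (hρ : Continuous ρ) {β m ℓ : ℝ} (hβ : 0 < β) (hm0 : 0 ≤ m) (hm : m ≤ 1 / 4)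
    {g : EuclideanSpace ℝ (Fin (dimE ρ)) → ℝ} (hg : ∀ a, ‖a‖ ≤ m → |Real.log (g a)| ≤ ℓ)
    {ϑ : Fin (dimE ρ) → Literature.MathematicalPhysics.QuantumLattice.ZdEdge 4 → ℝ}
    (hforest : ∀ x : Site 4, (∀ k : Fin 4, 1 ≤ x k ∧ x k + 1 ≤ 2 * (H : ℤ)) → ∀ c, ϑ c (x, 0) = 0)
    (hϑ : ∀ e, e ∉ boxEdges 4 (2 * H + 1) → ‖datVec ϑ e‖ ≤ m) (t : TSpaceD H (dimE ρ))
    (ht : ∀ e : ColdFreeIdx H, ‖unscaleTE H (dimE ρ) β (t + meanTE H (dimE ρ) β ϑ) e‖ ≤ m) :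
    |tiltWDE ρ H g β ϑ t| ≤
      #(plaquettesTouching (boxEdges 4 (2 * H + 1))) * (190 * β * m ^ 3) + Fintype.card (ColdFreeIdx H) * ℓ :=
  abs_tiltWDE_le ρ hρ hβ hm hg hforest t (norm_extDatum_le_of_datVec_window ρ ϑ _ hm0 hϑ ht)

/-- **The tilt bound ON THE GOOD EVENT `S = goodTDE ∩ ball(m)`** (the shape `(hWb)` of the lead's cores): for `t ∈ S`,
`|S.indicator (tiltWDE ρ H g β ϑ) t| ≤ #(plaquettesTouching Λ)·190·β·m³ + #(ColdFreeIdx H)·ℓ`, and the same bound for every `t` (the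
indicator vanishes off `S`) provided the right-hand side is nonnegative. -/
theorem abs_indicator_tiltWDE_le (hρ : Continuous ρ) {β ε m ℓ : ℝ} (hβ : 0 < β) (hm0 : 0 ≤ m) (hm : m ≤ 1 / 4) (hℓ : 0 ≤ ℓ)
    {g : EuclideanSpace ℝ (Fin (dimE ρ)) → ℝ} (hg : ∀ a, ‖a‖ ≤ m → |Real.log (g a)| ≤ ℓ)
    {ϑ : Fin (dimE ρ) → Literature.MathematicalPhysics.QuantumLattice.ZdEdge 4 → ℝ}
    (hforest : ∀ x : Site 4, (∀ k : Fin 4, 1 ≤ x k ∧ x k + 1 ≤ 2 * (H : ℤ)) → ∀ c, ϑ c (x, 0) = 0)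
    (hϑ : ∀ e, e ∉ boxEdges 4 (2 * H + 1) → ‖datVec ϑ e‖ ≤ m) (t : TSpaceD H (dimE ρ)) :
    |(goodTDE ρ H β ε ϑ ∩ {t | ∀ e : ColdFreeIdx H, ‖unscaleTE H (dimE ρ) β (t + meanTE H (dimE ρ) β ϑ) e‖ ≤ m}).indicator
        (tiltWDE ρ H g β ϑ) t| ≤
      #(plaquettesTouching (boxEdges 4 (2 * H + 1))) * (190 * β * m ^ 3) + Fintype.card (ColdFreeIdx H) * ℓ := by
  by_cases ht : t ∈ goodTDE ρ H β ε ϑ ∩ {t | ∀ e : ColdFreeIdx H, ‖unscaleTE H (dimE ρ) β (t + meanTE H (dimE ρ) β ϑ) e‖ ≤ m}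
  · rw [Set.indicator_of_mem ht]
    exact abs_tiltWDE_le_of_window ρ hρ hβ hm0 hm hg hforest hϑ t ht.2
  · rw [Set.indicator_of_notMem ht, abs_zero]
    positivity

end Chart

end Summit.QuantumFields.YangMills.Theorems.ColdBoxAllGroups

end
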